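/-
Copyright: pub-rosobs cell (Resolution Observatory), carver gen 49.  Companion file; statements OURS — LEMMA Γ (b)+(c) of the
cell's BOOTSTRAP LEMMA (engine 1 gen 33, THEOREM-LC §6 (2); CARVER-NOTES-eng1-g33 T12 inputs (ii)+(iii)) as ONE displayed
statement, combining `WeightedCentreIsotropyTwist` (the twist σ ↦ −σ) with `WeightedCentreUnipotentIsotropy` (truncated
unipotent operators).  Instrument — NOT a resolution theorem, NOT a statement about the invariant of
[AbramovichTemkinWlodarczyk2024], NOT summit progress.
-/
import Literature.AlgebraicGeometry.Resolution.WeightedCentreUnipotentIsotropy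
import Literature.AlgebraicGeometry.Resolution.WeightedCentreIsotropyTwist
import Mathlib.Algebra.Polynomial.Coeff
import HarnessLib

/-!
# `Γ_σ^p ≡ id` and `Γ_σ^{p−1} ∘ Γ_{−σ} ≡ id (mod σ³)` for an isotropy `Φ ≡ id (mod σ)`

Setting: `k` a commutative ring, `A₀` a commutative `k`-algebra of characteristic `p` (cell: `A₀ = k[ε_N]`, `k` a field of
characteristic `p`), `A₀[X]` with `X = σ`, and `Φ : A₀[X] →ₐ[k] A₀[X]` with `Φ X = X` and `Φ (C a) − C a ∈ (X)` for all `a`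
(an isotropy `≡ id (mod σ)`; no grading and no `g` are needed for these congruences).  With `Γ_σ := gammaOf Φ = Φ ∘ Φ_{−σ}`
and `Γ_{−σ} := twistConj (gammaOf Φ) = Φ_{−σ} ∘ Φ`:

* `gammaOf_iterate_char_sub_self_mem_span_fourth` : `Γ_σ^p ≡ id (mod σ⁴)`, hence `…_span_cube` : `(mod σ³)`;
* `gammaOf_iterate_pred_char_twistConj_sub_self_mem` : `Γ_σ^{p−1} ∘ Γ_{−σ} ≡ id (mod σ³)` (`p` prime).

These are the two "cubic-order" maps of BOOTSTRAP step (2); in the cell they are then the identity by step (1) (`O_ρ`), which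
is NOT typed here (it needs PURE(ρ), the grading and the induction on `|N|` — T12 proper).  Proof = the hypotheses
`gammaOf_sub_self_mem_map`, `twistConj_gammaOf_sub_self_mem_map`, `twistConj_gammaOf_sub_gammaOf_mem_map` of the twist file fed
into `iterate_char_sub_self_mem_span_fourth` / `iterate_pred_char_comp_sub_self_mem_span_cube` of the unipotent file through
the `k[X]`-algebra upgrade `toPolyAlgHom` (Mathlib's local instance `Polynomial.algebra`, used only inside the proofs: the
STATEMENTS below are instance-free).  Pattern cite [cite: SerreLocalFields1979, Ch. II §4 Lemma 1]; formalisation ours.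
-/

namespace Literature.AlgebraicGeometry.Resolution.WeightedBlowup

open Polynomial

variable {k : Type*} [CommRing k] {A₀ : Type*} [CommRing A₀] [Algebra k A₀]

section

-- Mathlib's non-global `Algebra k[X] A₀[X]` (`X ↦ X`), enabled locally as in `RingTheory.PolynomialAlgebra`; it appears only
-- inside the proofs below (to form `toPolyAlgHom`), never in a statement.
attribute [local instance] Polynomial.algebra

/-- **LEMMA Γ (c), first map, sharp form**: `Γ_σ^p ≡ id (mod σ⁴)` for an isotropy `Φ ≡ id (mod σ)` in characteristic `p`
(derived here). [cite: SerreLocalFields1979, Ch. II §4 Lemma 1] -/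
theorem gammaOf_iterate_char_sub_self_mem_span_fourth (p : ℕ) [CharP A₀ p] (Φ : A₀[X] →ₐ[k] A₀[X])
    (hX : Φ X = X) (hΦ : ∀ a, Φ (C a) - C a ∈ Ideal.span {(X : A₀[X])}) (f : A₀[X]) :
    (⇑(gammaOf (Φ : A₀[X] →+* A₀[X])))^[p] f - f ∈ Ideal.span {(X : A₀[X]) ^ 4} := by
  have h := iterate_char_sub_self_mem_span_fourth p (X : k[X])
    (toPolyAlgHom k (gammaOf (Φ : A₀[X] →+* A₀[X])) (gammaOf_X hX) (gammaOf_C_algebraMap Φ))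
    (fun a => gammaOf_sub_self_mem_map Φ hX hΦ a) f
  rwa [map_span_X_pow] at h

/-- **LEMMA Γ (c), first map**: `Γ_σ^p ≡ id (mod σ³)` (derived here; the form used in BOOTSTRAP (2)).
[cite: SerreLocalFields1979, Ch. II §4 Lemma 1] -/
theorem gammaOf_iterate_char_sub_self_mem_span_cube (p : ℕ) [CharP A₀ p] (Φ : A₀[X] →ₐ[k] A₀[X])
    (hX : Φ X = X) (hΦ : ∀ a, Φ (C a) - C a ∈ Ideal.span {(X : A₀[X])}) (f : A₀[X]) :
    (⇑(gammaOf (Φ : A₀[X] →+* A₀[X])))^[p] f - f ∈ Ideal.span {(X : A₀[X]) ^ 3} := by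
  have h := iterate_char_sub_self_mem_span_cube p (X : k[X])
    (toPolyAlgHom k (gammaOf (Φ : A₀[X] →+* A₀[X])) (gammaOf_X hX) (gammaOf_C_algebraMap Φ))
    (fun a => gammaOf_sub_self_mem_map Φ hX hΦ a) f
  rwa [map_span_X_pow] at h

/-- **LEMMA Γ (c), second map**: `Γ_σ^{p−1} ∘ Γ_{−σ} ≡ id (mod σ³)` for an isotropy `Φ ≡ id (mod σ)`, `p` prime,
characteristic `p` (derived here; `Γ_{−σ} = twistConj (gammaOf Φ) = Φ_{−σ} ∘ Φ_σ`).
[cite: SerreLocalFields1979, Ch. II §4 Lemma 1] -/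
theorem gammaOf_iterate_pred_char_twistConj_sub_self_mem (p : ℕ) [Fact p.Prime] [CharP A₀ p]
    (Φ : A₀[X] →ₐ[k] A₀[X]) (hX : Φ X = X) (hΦ : ∀ a, Φ (C a) - C a ∈ Ideal.span {(X : A₀[X])})
    (f : A₀[X]) :
    (⇑(gammaOf (Φ : A₀[X] →+* A₀[X])))^[p - 1] (twistConj (gammaOf (Φ : A₀[X] →+* A₀[X])) f) - f
      ∈ Ideal.span {(X : A₀[X]) ^ 3} := by
  have h := iterate_pred_char_comp_sub_self_mem_span_cube p (X : k[X])
    (toPolyAlgHom k (gammaOf (Φ : A₀[X] →+* A₀[X])) (gammaOf_X hX) (gammaOf_C_algebraMap Φ))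
    (toPolyAlgHom k (twistConj (gammaOf (Φ : A₀[X] →+* A₀[X])))
      (twistConj_X _ (gammaOf_X hX)) (twistConj_gammaOf_C_algebraMap Φ))
    (fun a => gammaOf_sub_self_mem_map Φ hX hΦ a) (fun a => twistConj_gammaOf_sub_self_mem_map Φ hX hΦ a)
    (fun a => twistConj_gammaOf_sub_gammaOf_mem_map Φ hX hΦ a) f
  rwa [map_span_X_pow] at h

end

/-- The same two congruences for the monoid powers `Γ_σ ^ p`, `Γ_σ ^ (p − 1)` in `A₀[X] →+* A₀[X]` (plumbing).
[cite: SerreLocalFields1979, Ch. II §4 Lemma 1] -/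
theorem gammaOf_pow_char_sub_self_mem_span_cube (p : ℕ) [CharP A₀ p] (Φ : A₀[X] →ₐ[k] A₀[X])
    (hX : Φ X = X) (hΦ : ∀ a, Φ (C a) - C a ∈ Ideal.span {(X : A₀[X])}) (f : A₀[X]) :
    (gammaOf (Φ : A₀[X] →+* A₀[X]) ^ p) f - f ∈ Ideal.span {(X : A₀[X]) ^ 3} := by
  rw [RingHom.coe_pow]
  exact gammaOf_iterate_char_sub_self_mem_span_cube p Φ hX hΦ f

/-- If, as in BOOTSTRAP step (1), every endomorphism `≡ id (mod σ³)` in play is the identity, then `Γ_{−σ} = Γ_σ ∘ …` bookkeeping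
gives: `Γ_σ^p = id` and `Γ_σ^{p−1} ∘ Γ_{−σ} = id` imply `Γ_{−σ} = Γ_σ^{p} ∘ … = Γ_σ` — here only the purely algebraic last step:
`Γ^p = 1` and `Γ^(p−1) * Γ' = 1` in a monoid imply `Γ' = Γ` (derived here). [cite: SerreLocalFields1979, Ch. II §4 Lemma 1] -/
theorem eq_of_pow_eq_one_of_pow_pred_mul_eq_one {M : Type*} [Monoid M] {Γ Γ' : M} {p : ℕ} (hp : 1 ≤ p)
    (h1 : Γ ^ p = 1) (h2 : Γ ^ (p - 1) * Γ' = 1) : Γ' = Γ := by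
  have h3 : Γ * (Γ ^ (p - 1) * Γ') = Γ := by rw [h2, mul_one]
  rw [← mul_assoc, ← pow_succ', Nat.sub_add_cancel hp, h1, one_mul] at h3
  exact h3

end Literature.AlgebraicGeometry.Resolution.WeightedBlowup
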